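/- Copyright: the b2b-balaban cell (near-miss cell 7), T⁴-continuum fan-out; row NE7b CRUX team (2), OWNER seat
t4-ne7b-p1 (gen 54) — (α)-JOINT AT THE CENSUS LETTERS, part 0: the letters at `d = 4`, `L = 13`, `M = 13`, `β₀ = 1∕7`.
Released under the licence of the surrounding project. -/
import Summits.QuantumFields.BalabanUV.T4Continuum.Support.HistoryRealiseCellsRunAssemblyWTVSJointLetters

/-!
# (α)-JOINT AT THE CENSUS LETTERS, part 0: ONE TUPLE AT RECORD DIMENSION `d = 4`, BLOCKING `L = 13`, PRINT's BLOCK CONSTANT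
`M = 13` AND PRINT's `β₀ = 1∕7` MEETING EVERY LETTER-LEVEL BINDER OF THE TERMINAL THEOREM AND OF ITS RECORD AT ONCE
(owner lineage `t4-ne7b-p1` gen 54; sequel of IR-54-1 (J1) `…JointLetters`)

Summits-side support leaf of the T⁴-continuum cell (rung (B)+1 on a FINITE torus only; NOT infinite volume, NOT the
mass gap, NOT Clay; NOT a proof of NE7b — the cell's OWN estimate, NOT PRINTED, NOT PROVED).  [decided arithmetic]
Two `def`s (`C₁₃`, `O₄`) and decided (in)equalities; nothing printed asserted, no `def … : Prop` fact, no cite-tagged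
hypothesis, zero `sorry`.

WHY.  IR-54-1's joint tuple (`…JointLetters`: `Cj`, `Lj = 87781`, `O₁`, record dimension `d = 1`) is SOME admissible
tuple.  The cell's CENSUS is booked at `d = 4`, `L = 13`, `M = 13`, collar `c = 32` (ROW-NE7b-STATE §4; balaban-calc
G37–G40 «VOLUME-k», instance of record `(L, M) = (13, 13)`), and [B16] p. 389 suggests «for example, take β₀ = 1∕7».
THIS FILE shows the letter-level binders of the terminal theorem `continuumYM4Torus_of_histReadingLWL_fsc` (p303949) and
of the record `HistReadDataLWL` are jointly satisfiable AT THOSE LETTERS too — the `hsmall` row then forces the count's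
step letter `sS ≥ 34` (at `sS = 32` it fails), and `θc := 49∕50`.

WHAT.  §1 `C₁₃ := ⟨13, 0, 6, 1, 1, 54, 2, 0, 1, 1∕2, 1, 8⟩` (`n₁ dC q′ E₂ E₃ κ₁ E₀ Eb μ a A₀ p₀`; `q′ = 6`, `p₀ = 8` so that
`rr·(q′+1) = 7 < p₀` and `1 + κ₂ = rr·(q′ − 4)` has `κ₂ = 1`), `O₄ := ⟨4, 13, 2, 1, 1∕7, 1, 1, 1, 1⟩`
(`d M γ₀ A₁ β₀ o80 o81 o87 o88`).  §2 `thresholdOK_C₁₃ : ThresholdOK C₁₃ 13 1 (1∕13)`; `joint_outside_C₁₃` — the terminal's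
seventeen outside letter binders at `(C, L, rr, d, n, θ, θv, sS, θc, β₀) = (C₁₃, 13, 1, 4, 1, 1∕8, 1∕8, 34, 49∕50, 1∕13)`
against `O₄`, verbatim and in order.  §3 `joint_record_C₁₃` — the record's 26 letter rows at `(C₁₃, O₄, rr = 1, d = 4)`,
census `(p₁, η, η′, κ, κ₂, κᵥ) = (8, 1, 2, 9, 1, 11)`, `b₀ = 1∕13`.  §4 `not_hsmall_13_32`: at `sS = 32` the `hsmall` row
FAILS at `L = 13`, `d = 4` (located: the smallness step letter is forced `≥ 34` there).

HONEST.  Decided arithmetic over OUR letters at the census's `(d, L, M) = (4, 13, 13)` and print's `β₀ = 1∕7`; print's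
other O(1)'s (`γ₀`, `A₁`, `o80…o88`) and every model constant of `C₁₃` stay UNVALUED symbols chosen by us (ρ = cΛ∕c_{E₂}
UNVALUED).  Nothing of Bałaban's is discharged; every R-class row of the wall stays; NE7b NOT PRINTED ∕ NOT PROVED;
spine 0∕9.  HONEST DEPENDENCY (cell): continuum YM on T⁴ ⇐ BetaPertH ∧ nine spine estimates (0/9 proved); BetaPertH
⇐ (D1) ∧ (D4) ∧ CAP+tail; G-an2-4 gates asym, D1 and NE2/3/4.  Unchanged here.
-/

open Literature.MathematicalPhysics.QuantumFieldTheory.Balaban1983to89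
open Summit.QuantumFields.BalabanUV.T4Continuum.CountThresholdUniform (ThresholdOK)
open Summit.QuantumFields.BalabanUV.T4Continuum.HistoryZoneEvolve (cth)
open Summit.QuantumFields.BalabanUV.T4Continuum.HistoryConstants (PrintedO1s)
open Summit.QuantumFields.BalabanUV.T4Continuum.HistoryRealiseCellsRunAssemblyWTVSJointLetters
  (Cj birthMass_Cj_le_one birthMass_Cj_nonneg)

namespace Summit.QuantumFields.BalabanUV.T4Continuum.HistoryRealiseCellsRunAssemblyWTVSJointLetters13

noncomputable section

/-! ## §1 The letters at `(d, L, M, β₀) = (4, 13, 13, 1∕7)` -/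

/-- THE CENSUS-LETTER SYMBOLIC CONSTANTS `C₁₃ = ⟨n₁, dC, q′, E₂, E₃, κ₁, E₀, Eb, μ, a, A₀, p₀⟩ := ⟨13, 0, 6, 1, 1, 54, 2, 0,
1, 1∕2, 1, 8⟩`. [decided arithmetic] -/
def C₁₃ : T4PrintedShapeBanking.Consts := ⟨13, 0, 6, 1, 1, 54, 2, 0, 1, 1 / 2, 1, 8⟩

/-- PRINT-SHAPED O(1)'s AT `d = 4`: `O₄ = ⟨d, M, γ₀, A₁, β₀, o80, o81, o87, o88⟩ := ⟨4, 13, 2, 1, 1∕7, 1, 1, 1, 1⟩` — the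
census's block constant `M = 13` and print's «take β₀ = 1∕7» (B16 p. 389); `γ₀, A₁, o…` unvalued symbols. [decided
arithmetic] -/
def O₄ : PrintedO1s := ⟨4, 13, 2, 1, 1 / 7, 1, 1, 1, 1⟩

/-- field read-back [decided arithmetic] -/ @[simp] theorem C₁₃_n₁ : C₁₃.n₁ = 13 := rfl
/-- field read-back [decided arithmetic] -/ @[simp] theorem C₁₃_dC : C₁₃.dC = 0 := rfl
/-- field read-back [decided arithmetic] -/ @[simp] theorem C₁₃_q' : C₁₃.q' = 6 := rfl
/-- field read-back [decided arithmetic] -/ @[simp] theorem C₁₃_E₂ : C₁₃.E₂ = 1 := rfl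
/-- field read-back [decided arithmetic] -/ @[simp] theorem C₁₃_E₃ : C₁₃.E₃ = 1 := rfl
/-- field read-back [decided arithmetic] -/ @[simp] theorem C₁₃_κ₁ : C₁₃.κ₁ = 54 := rfl
/-- field read-back [decided arithmetic] -/ @[simp] theorem C₁₃_E₀ : C₁₃.E₀ = 2 := rfl
/-- field read-back [decided arithmetic] -/ @[simp] theorem C₁₃_Eb : C₁₃.Eb = 0 := rfl
/-- field read-back [decided arithmetic] -/ @[simp] theorem C₁₃_μ : C₁₃.μ = 1 := rfl
/-- field read-back [decided arithmetic] -/ @[simp] theorem C₁₃_a : C₁₃.a = 1 / 2 := rfl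
/-- field read-back [decided arithmetic] -/ @[simp] theorem C₁₃_A₀ : C₁₃.A₀ = 1 := rfl
/-- field read-back [decided arithmetic] -/ @[simp] theorem C₁₃_p₀ : C₁₃.p₀ = 8 := rfl
/-- field read-back [decided arithmetic] -/ @[simp] theorem O₄_d : O₄.d = 4 := rfl
/-- field read-back [decided arithmetic] -/ @[simp] theorem O₄_M : O₄.M = 13 := rfl
/-- field read-back [decided arithmetic] -/ @[simp] theorem O₄_γ₀ : O₄.γ₀ = 2 := rfl
/-- field read-back [decided arithmetic] -/ @[simp] theorem O₄_A₁ : O₄.A₁ = 1 := rfl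
/-- field read-back [decided arithmetic] -/ @[simp] theorem O₄_β₀ : O₄.β₀ = 1 / 7 := rfl

/-- the thickening radius of `34` collapsed steps at `c = 32`, `L = 1` is `34·33 = 1122` [decided arithmetic] -/
theorem cth_32_1_34 : cth 32 1 34 = 1122 := by decide

/-- … and of `32` steps `1056` [decided arithmetic] -/
theorem cth_32_1_32 : cth 32 1 32 = 1056 := by decide

/-- `birthMass` reads only `Eb` and `μ`, which `C₁₃` shares with `Cj`: `birthMass C₁₃ = birthMass Cj`. [decided arithmetic] -/
theorem birthMass_C₁₃ : T4CanonicalMenus.birthMass C₁₃ = T4CanonicalMenus.birthMass Cj := rfl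

/-! ## §2 The OUTSIDE binders of the terminal theorem at `(C₁₃, L = 13, rr = 1, β₀ = 1∕13, d = 4)` -/

/-- `C₁₃` is valid. [decided arithmetic] -/
theorem valid_C₁₃ : C₁₃.Valid where
  E₂_nonneg := by norm_num
  E₃_nonneg := by norm_num
  κ₁_nonneg := by norm_num
  E₀_nonneg := by norm_num
  Eb_nonneg := le_rfl
  μ_nonneg := by norm_num
  dC_le := by simp [T4PersistenceDictionary.fatWait]

/-- **`ThresholdOK C₁₃ 13 1 (1∕13)`** (`rq_lt : 1·(6+1) < 8`). [decided arithmetic] -/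
theorem thresholdOK_C₁₃ : ThresholdOK C₁₃ 13 1 (1 / 13) where
  valid := valid_C₁₃
  a_pos := by norm_num
  A₀_pos := by norm_num
  one_le_L := by norm_num
  β₀_nonneg := by norm_num
  rq_lt := by decide

/-- **THE SEVENTEEN OUTSIDE LETTER BINDERS AT THE CENSUS LETTERS**, jointly, at `C := C₁₃`, `F.L := 13`, `rr := 1`,
`β₀ := 1∕13`, `d := 4`, `n := 1`, `θ := θv := 1∕8`, `O := O₄`, `sS := 34`, `θc := 49∕50` — in the terminal's order:
`hμ hκ₁ hE₀ hA₀ hβ₀ hLβ hn₁ hn hθ hslack hE₂ hE₃ hsS hsmall hθc0 hθc1 hθcs`. [decided arithmetic] -/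
theorem joint_outside_C₁₃ :
    0 < C₁₃.μ ∧
    ((4 : ℕ) : ℝ) * Real.log ((13 : ℕ) : ℕ) + 2 * Real.log 2 ≤ C₁₃.κ₁ ∧
    Real.log (2 + T4CanonicalMenus.birthMass C₁₃) ≤ C₁₃.E₀ ∧
    1 ≤ C₁₃.A₀ ∧
    (0 : ℝ) < 1 / 13 ∧ ((13 : ℕ) : ℝ) * (1 / 13) ≤ 1 ∧
    13 ≤ C₁₃.n₁ ∧ (0 : ℕ) < 1 ∧
    (0 : ℝ) < 1 / 8 ∧ C₁₃.a + (1 / 8 + 1 / 8) ≤ O₄.γ₀ * O₄.A₁ ^ 2 / 2 ∧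
    0 < C₁₃.E₂ ∧ 0 ≤ C₁₃.E₃ ∧ (1 : ℕ) ≤ 34 ∧
    (((2 * cth 32 1 34 + 1) ^ 4 : ℕ) : ℝ) * (5 : ℝ) ^ 4 * ((max 1 (2 * 32 + 2) : ℕ) : ℝ) ≤
        ((13 : ℕ) : ℝ) ^ (34 / 2) / 2 ∧
    (0 : ℝ) ≤ 49 / 50 ∧ (49 / 50 : ℝ) < 1 ∧ (1 / 2 : ℝ) ≤ (49 / 50) ^ 34 := by
  refine ⟨by norm_num, ?_, ?_, by norm_num, by norm_num, by norm_num, by norm_num, one_pos, by norm_num, ?_, by norm_num,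
    by norm_num, by norm_num, ?_, by norm_num, by norm_num, by norm_num⟩
  · -- `4 log 13 + 2 log 2 ≤ 4·12 + 2 = 50 ≤ 54`
    have h1 : Real.log (13 : ℝ) ≤ (13 : ℝ) - 1 := Real.log_le_sub_one_of_pos (by norm_num)
    have h2 : Real.log 2 < 1 := by
      have := Real.log_two_lt_d9; linarith
    have h13 : (((13 : ℕ) : ℕ) : ℝ) = (13 : ℝ) := by norm_num
    rw [h13]
    simp only [C₁₃_κ₁, Nat.cast_ofNat]
    linarith
  · have h1 : Real.log (2 + T4CanonicalMenus.birthMass C₁₃) ≤ 2 + T4CanonicalMenus.birthMass C₁₃ - 1 :=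
      Real.log_le_sub_one_of_pos (by rw [birthMass_C₁₃]; linarith [birthMass_Cj_nonneg])
    rw [birthMass_C₁₃] at h1 ⊢
    simp only [C₁₃_E₀]
    linarith [birthMass_Cj_le_one]
  · norm_num [O₄]
  · rw [cth_32_1_34]; norm_num

/-! ## §3 The RECORD's letter rows at the same constants, `d = 4` -/

/-- **THE 26 LETTER ROWS OF `HistReadDataLWL` AT `(C₁₃, O₄)`, RECORD DIMENSION `d = 4`**, `rr := 1`, census letters
`(p₁, η, η′, κ, κ₂, κᵥ) := (8, 1, 2, 9, 1, 11)`, window letters `cΛ = M = Lr = Φ := 0`, `b₀ := 1∕13`, `θv := 1∕8` — in the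
constructor's order (`histReadDataLWL₆ 4`): `hn₁ hE₂ hE₃ hp₀ hA₀ hγ₀ hA₁ hMO hβd hθv hcΛ hMΛ hLr hΦ hβ₀ hexpR hexpR′ hexpB
hexpFL hdq hexpVL hη hη′ hκ hκ₂ hκᵥ`. [decided arithmetic] -/
theorem joint_record_C₁₃ :
    13 ≤ C₁₃.n₁ ∧ 0 < C₁₃.E₂ ∧ 0 < C₁₃.E₃ ∧ 1 ≤ C₁₃.p₀ ∧ 0 < C₁₃.A₀ ∧ 0 < O₄.γ₀ ∧ O₄.A₁ ≠ 0 ∧ 0 < O₄.M ∧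
    O₄.β₀ * ((O₄.d : ℝ) + 2) ≤ 1 ∧ (0 : ℝ) < 1 / 8 ∧
    (0 : ℝ) ≤ 0 ∧ (0 : ℝ) ≤ 0 ∧ (0 : ℝ) ≤ 0 ∧ (0 : ℝ) ≤ 0 ∧ (0 : ℝ) ≤ 1 / 13 ∧
    C₁₃.p₀ + 1 * (O₄.d + 3) + 1 = 2 * 8 ∧ 1 * (C₁₃.q' + 1) + 1 * (O₄.d + 3) + 2 = 2 * 8 ∧
    1 * (C₁₃.q' + 1) + 9 = 2 * C₁₃.p₀ ∧ 1 + 1 = 1 * (C₁₃.q' - 4) ∧ 4 ≤ C₁₃.q' ∧ 1 + 1 * 4 + 11 = 2 * C₁₃.p₀ ∧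
    (1 : ℕ) ≤ 1 ∧ (1 : ℕ) ≤ 2 ∧ (1 : ℕ) ≤ 9 ∧ (1 : ℕ) ≤ 1 ∧ (1 : ℕ) ≤ 11 := by
  refine ⟨by norm_num, by norm_num, by norm_num, by norm_num, by norm_num, by norm_num [O₄], by norm_num [O₄],
    by norm_num [O₄], by norm_num [O₄], by norm_num, le_rfl, le_rfl, le_rfl, le_rfl, by norm_num, ?_, ?_, ?_, ?_, ?_, ?_,
    le_rfl, by norm_num, by norm_num, le_rfl, by norm_num⟩ <;> decide

/-! ## §4 Located: the smallness step letter at the census letters -/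

/-- **AT `sS = 32` THE `hsmall` ROW FAILS AT `L = 13`, `d = 4`** (`(2·1056+1)⁴·5⁴·66 > 13¹⁶∕2`): the count's step letter
is forced `≥ 34` at the census letters (`sS = 33` has the same right-hand side `13^16`). [decided arithmetic] -/
theorem not_hsmall_13_32 :
    ¬ ((((2 * cth 32 1 32 + 1) ^ 4 : ℕ) : ℝ) * (5 : ℝ) ^ 4 * ((max 1 (2 * 32 + 2) : ℕ) : ℝ) ≤
        ((13 : ℕ) : ℝ) ^ (32 / 2) / 2) := by
  rw [cth_32_1_32]; norm_num

end

end Summit.QuantumFields.BalabanUV.T4Continuum.HistoryRealiseCellsRunAssemblyWTVSJointLetters13
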